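import Literature.NumberTheory.Sieve.BombieriFriedlanderIwaniecBilinear
import Literature.NumberTheory.Sieve.LargeSieveCharacters
import Literature.NumberTheory.Sieve.DivisorPowerSums
import HarnessLib

/-!
# Bombieri–Friedlander–Iwaniec 1986, Theorem 0 (b): the bilinear Bombieri–Vinogradov theorem, PROVED

Sibling proofs file of `Literature.NumberTheory.Sieve.BombieriFriedlanderIwaniecBilinear`.  It
discharges the named fact `Literature.NumberTheory.Sieve.BombieriFriedlanderIwaniecTheorem0b` —
**Theorem 0 (b)** of E. Bombieri, J. B. Friedlander, H. Iwaniec, *Primes in arithmetic progressions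
to large moduli*, Acta Math. 156 (1986), 203–251, §2, pp. 211–213 ("the formulation of the
Bombieri–Vinogradov theorem in terms of general bilinear forms", "essentially due to Y. Motohashi"):
under (A₁), (A₂), for every `A > 0` there is `B₁ > 0` with
`∑_{q ≤ Q} max_{(a,q)=1} |Δ_{α⋆β}(x; q, a)| ≪ ‖α‖ ‖β‖ x^{1/2} ℒ^{−A}` for `Q ≤ x^{1/2} ℒ^{−B₁}` —
by the proof printed on pp. 212–213, with every constant explicit:

* **Step 1** (`BFI.abs_bilinDisc_le_sum_char`): orthogonality,
  `|Δ_{α⋆β}(q,a)| ≤ φ(q)⁻¹ ∑_{χ ≠ χ₀} |∑_m α_m χ(m)| |∑_n β_n χ(n)|` (Mathlib's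
  `DirichletCharacter.sum_char_inv_mul_char_eq`).
* **Step 2** (`BFI.sum_char_le_sum_primIndex_coprime`): reduction to primitive characters — each
  `χ ≠ χ₀ (mod q)` is induced by a primitive `ψ (mod d)`, `d ∣ q`, `d > 1`, and
  `∑_m α_m χ(m) = ∑_{(m, q/d)=1} α_m ψ(m)` (the index set `primIndex` of
  `BombieriVinogradovFacts.lean`).
* **Step 3** (`BFI.sum_inv_totient_mul_sum_divisors_le`): `q = de`, `φ(de) ≥ φ(d)φ(e)`:
  `T ≤ ∑_e φ(e)⁻¹ ∑_d φ(d)⁻¹ H(d, e)` ((2.4)).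
* **Step 4** (`BFI.norm_sum_coprime_mul_char_le_of_SW`): for small conductors, hypothesis (A₂)
  applied class by class and `∑_u ψ(u) = 0` give
  `|∑_{(n,e)=1} β_n ψ(n)| ≤ φ(d) C(A') ‖β‖ N^{1/2} τ(e)^B (log 2N)^{−A'}`; on the `α`-side we use
  the trivial bound `|∑ α_m ψ(m)| ≤ (M+1)^{1/2} ‖α‖` (so `F²` replaces the `F^{3/2}` of (2.6); the
  loss is absorbed by the choice of `A'`).
* **Step 5** (`BFI.sum_Ioc_inv_totient_mul_le`, `BFI.sum_Ioc_inv_totient_mul_le_of_dyadic`): for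
  large conductors, dyadic blocks `V < d ≤ 2V`, `φ(d)⁻¹ ≤ V⁻¹ d/φ(d)`, Cauchy's inequality and the
  multiplicative large sieve (`Literature.NumberTheory.Sieve.LargeSieve.largeSieve_bilinear`,
  proved in `LargeSieveCharacters.lean`), giving (2.7) with the constants
  `2√(M+2)√(N+2)/F + 3K(√(M+2)+√(N+2)) + 9F·2^K` (`K` blocks).
* **Step 6** (`BFI.sum_abs_bilinDisc_le_main`): the skeleton estimate before the choice of
  parameters; **Step 7** (`BombieriFriedlanderIwaniecTheorem0b_holds`): `F = ⌈ℒ^{A+2}⌉`,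
  `B₁ = 2A + 4`, `A' = 3A + 4 + 2^{⌈B⌉+2}` (the exponent of `ℒ` in
  `∑_{e ≤ Q} τ(e)^B/φ(e) ≪ ℒ^{2^{⌈B⌉+2}}`,
  `Literature.NumberTheory.Sieve.exists_sum_sigma_zero_pow_div_totient_le_real`),
  and the eventual inequalities `ℒ^{A+3} ≤ x^{ε/2}`, `ℒ^{2A+4} ≤ x^{1/2}`.

The constants differ from the printed `B₁ = A + 2`, `A' = 5A/2 + B₂ + 3` only through the cruder
(but explicit) bookkeeping (`∑_{e} 1/φ(e) ≤ (1 + log Q)²` instead of `≪ log Q`, the trivial bound in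
Step 4); the statement proved is the vendored one verbatim.

## References

* E. Bombieri, J. B. Friedlander, H. Iwaniec, *Primes in arithmetic progressions to large moduli*,
  Acta Math. 156 (1986), 203–251: §2, Theorem 0 and its proof, pp. 211–213.
  [BombieriFriedlanderIwaniecActa1986]
* A. C. Cojocaru, M. R. Murty, *An Introduction to Sieve Methods and their Applications*
  (CUP, 2005), Thm 8.3.1 (the large sieve for characters). [CojocaruMurty2005]
-/

open Finset Real
open scoped ArithmeticFunction.sigma

namespace Literature.NumberTheory.Sieve

namespace BFI

/-! ### Dyadic ranges as integer intervals -/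

/-- For `M ≥ 0`, `m ∼ M` is the integer interval `(⌊M⌋, ⌊2M⌋]`. [folklore] -/
theorem dyadic_eq_Ioc {M : ℝ} (hM : 0 ≤ M) : dyadic M = Ioc ⌊M⌋₊ ⌊2 * M⌋₊ := by
  ext m
  rw [mem_dyadic hM, Finset.mem_Ioc, Nat.floor_lt hM, Nat.le_floor_iff (by linarith)]

/-- For `M ≥ 0`, `m ∼ M` is `(⌊M⌋, ⌊M⌋ + N']` with `N' = ⌊2M⌋ − ⌊M⌋ ≤ M + 1`. [folklore] -/
theorem dyadic_eq_Ioc_add {M : ℝ} (hM : 0 ≤ M) :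
    dyadic M = Ioc ⌊M⌋₊ (⌊M⌋₊ + (⌊2 * M⌋₊ - ⌊M⌋₊)) ∧ ((⌊2 * M⌋₊ - ⌊M⌋₊ : ℕ) : ℝ) ≤ M + 1 := by
  have hle : ⌊M⌋₊ ≤ ⌊2 * M⌋₊ := Nat.floor_le_floor (by linarith)
  refine ⟨by rw [dyadic_eq_Ioc hM, Nat.add_sub_cancel' hle], ?_⟩
  rw [Nat.cast_sub hle]
  have h1 : (⌊2 * M⌋₊ : ℝ) ≤ 2 * M := Nat.floor_le (by linarith)
  have h2 : M < (⌊M⌋₊ : ℝ) + 1 := Nat.lt_floor_add_one M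
  linarith

/-- `#{m ∼ M} ≤ M + 1` for `M ≥ 0`. [folklore] -/
theorem card_dyadic_le_add_one {M : ℝ} (hM : 0 ≤ M) : ((dyadic M).card : ℝ) ≤ M + 1 := by
  obtain ⟨h1, h2⟩ := dyadic_eq_Ioc_add hM
  rw [h1, Nat.card_Ioc, Nat.add_sub_cancel_left]
  exact h2

/-- The trivial bound for a character sum:
`|∑_{m ∈ s} c_m ψ(m)| ≤ (#s)^{1/2} (∑_{m ∈ s} |c_m|²)^{1/2}` (`|ψ| ≤ 1` and Cauchy's inequality).
[folklore] -/
theorem norm_sum_mul_char_le_sqrt_card {d : ℕ} (ψ : DirichletCharacter ℂ d) (s : Finset ℕ)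
    (c : ℕ → ℂ) :
    ‖∑ m ∈ s, c m * ψ m‖ ≤ Real.sqrt s.card * Real.sqrt (∑ m ∈ s, ‖c m‖ ^ 2) := by
  calc ‖∑ m ∈ s, c m * ψ m‖ ≤ ∑ m ∈ s, ‖c m * ψ m‖ := norm_sum_le _ _
    _ ≤ ∑ m ∈ s, 1 * ‖c m‖ := Finset.sum_le_sum fun m _ => by
        rw [norm_mul, one_mul]
        exact mul_le_of_le_one_right (norm_nonneg _) (ψ.norm_le_one _)
    _ ≤ Real.sqrt (∑ m ∈ s, (1 : ℝ) ^ 2) * Real.sqrt (∑ m ∈ s, ‖c m‖ ^ 2) :=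
        Real.sum_mul_le_sqrt_mul_sqrt _ _ _
    _ = _ := by rw [one_pow, Finset.sum_const, nsmul_eq_mul, mul_one]

/-! ### Step 1: orthogonality (BFI p. 212, first display of the proof of Theorem 0 (b)) -/

open scoped Classical in
/-- **Orthogonality** (BFI p. 212: "`Δ_{α⋆β}(x;q,a) = φ(q)⁻¹ ∑_{χ ≠ χ₀} χ̄(a) (∑_m α_m χ(m))
(∑_n β_n χ(n))`"), in the form `|Δ_{α⋆β}(q, a)| ≤ φ(q)⁻¹ ∑_{χ ≠ χ₀} |∑_m α_m χ(m)| |∑_n β_n χ(n)|`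
for `(q, a) = 1`. [cite: BombieriFriedlanderIwaniecActa1986, §2 p. 212] -/
theorem abs_bilinDisc_le_sum_char {q : ℕ} [NeZero q] {a : ℤ} (ha : IsCoprime (q : ℤ) a)
    (M N : ℝ) (α β : ℕ → ℝ) :
    |bilinDisc a M N α β q| ≤ (Nat.totient q : ℝ)⁻¹ *
      ∑ χ : DirichletCharacter ℂ q, if χ = 1 then 0 else
        ‖∑ m ∈ dyadic M, (α m : ℂ) * χ m‖ * ‖∑ n ∈ dyadic N, (β n : ℂ) * χ n‖ := by
  set u : (ZMod q)ˣ := ZMod.unitOfIsCoprime a ha.symm with hu_def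
  have hu : ((u : ZMod q)) = (a : ZMod q) := ZMod.coe_unitOfIsCoprime a ha.symm
  have hφpos : 0 < (Nat.totient q : ℝ) := by exact_mod_cast Nat.totient_pos.mpr (NeZero.pos q)
  have hφne : (Nat.totient q : ℂ) ≠ 0 := by exact_mod_cast hφpos.ne'
  set Sα : DirichletCharacter ℂ q → ℂ := fun χ => ∑ m ∈ dyadic M, (α m : ℂ) * χ m with hSα
  set Sβ : DirichletCharacter ℂ q → ℂ := fun χ => ∑ n ∈ dyadic N, (β n : ℂ) * χ n with hSβ
  -- orthogonality, per `(m, n)`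
  have horth : ∀ m n : ℕ,
      (if ((m * n : ℕ) : ZMod q) = (a : ZMod q) then ((α m : ℂ) * (β n : ℂ)) else 0) =
        (Nat.totient q : ℂ)⁻¹ * ∑ χ : DirichletCharacter ℂ q,
          χ (u : ZMod q)⁻¹ * χ ((m * n : ℕ) : ZMod q) * ((α m : ℂ) * (β n : ℂ)) := by
    intro m n
    rw [← Finset.sum_mul, DirichletCharacter.sum_char_inv_mul_char_eq ℂ u.isUnit, ← hu]
    by_cases h1 : ((m * n : ℕ) : ZMod q) = (u : ZMod q)
    · rw [if_pos h1, if_pos h1.symm, ← mul_assoc, inv_mul_cancel₀ hφne, one_mul]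
    · rw [if_neg h1, if_neg (Ne.symm h1), zero_mul, mul_zero]
  -- the congruence sum
  have h1 : (∑ m ∈ dyadic M, ∑ n ∈ dyadic N,
      (if ((m * n : ℕ) : ZMod q) = (a : ZMod q) then ((α m : ℂ) * (β n : ℂ)) else 0)) =
        (Nat.totient q : ℂ)⁻¹ *
          ∑ χ : DirichletCharacter ℂ q, χ (u : ZMod q)⁻¹ * (Sα χ * Sβ χ) := by
    simp_rw [horth, ← Finset.mul_sum]
    congr 1
    refine (Finset.sum_congr rfl fun m _ => Finset.sum_comm).trans ?_
    rw [Finset.sum_comm]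
    refine Finset.sum_congr rfl fun χ _ => ?_
    simp only [hSα, hSβ]
    rw [Finset.sum_mul_sum, Finset.mul_sum]
    refine Finset.sum_congr rfl fun m _ => ?_
    rw [Finset.mul_sum]
    refine Finset.sum_congr rfl fun n _ => ?_
    rw [Nat.cast_mul, map_mul]
    ring
  -- the coprimality sum
  have hone : ∀ m : ℕ, ((1 : DirichletCharacter ℂ q) (m : ZMod q)) =
      if m.Coprime q then 1 else 0 := by
    intro m
    split_ifs with h
    · exact MulChar.one_apply ((ZMod.isUnit_iff_coprime m q).2 h)
    · exact MulChar.map_nonunit _ (mt (ZMod.isUnit_iff_coprime m q).1 h)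
  have h2 : (∑ m ∈ dyadic M, ∑ n ∈ dyadic N,
      (if (m * n).Coprime q then ((α m : ℂ) * (β n : ℂ)) else 0)) = Sα 1 * Sβ 1 := by
    simp only [hSα, hSβ]
    rw [Finset.sum_mul_sum]
    refine Finset.sum_congr rfl fun m _ => Finset.sum_congr rfl fun n _ => ?_
    rw [hone m, hone n]
    by_cases hm : m.Coprime q
    · by_cases hn : n.Coprime q
      · rw [if_pos (Nat.coprime_mul_iff_left.2 ⟨hm, hn⟩), if_pos hm, if_pos hn]; ring
      · rw [if_neg (fun h => hn (Nat.coprime_mul_iff_left.1 h).2), if_neg hn]; ring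
    · rw [if_neg (fun h => hm (Nat.coprime_mul_iff_left.1 h).1), if_neg hm]; ring
  -- splitting off the principal character
  have hu' : IsUnit ((u : ZMod q))⁻¹ := by
    rw [ZMod.inv_coe_unit]; exact (u⁻¹).isUnit
  have hsplit : ∑ χ : DirichletCharacter ℂ q, χ (u : ZMod q)⁻¹ * (Sα χ * Sβ χ) =
      (∑ χ : DirichletCharacter ℂ q,
          if χ = 1 then 0 else χ (u : ZMod q)⁻¹ * (Sα χ * Sβ χ)) + Sα 1 * Sβ 1 := by
    have : ∀ χ : DirichletCharacter ℂ q, χ (u : ZMod q)⁻¹ * (Sα χ * Sβ χ) =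
        (if χ = 1 then 0 else χ (u : ZMod q)⁻¹ * (Sα χ * Sβ χ)) +
          (if χ = 1 then χ (u : ZMod q)⁻¹ * (Sα χ * Sβ χ) else 0) := fun χ => by
      split_ifs <;> simp
    rw [Finset.sum_congr rfl fun χ _ => this χ, Finset.sum_add_distrib, Finset.sum_ite_eq']
    rw [if_pos (Finset.mem_univ _), MulChar.one_apply hu', one_mul]
  -- casting `bilinDisc` to `ℂ`
  have hcast : ((bilinDisc a M N α β q : ℝ) : ℂ) =
      (∑ m ∈ dyadic M, ∑ n ∈ dyadic N,
          (if ((m * n : ℕ) : ZMod q) = (a : ZMod q) then ((α m : ℂ) * (β n : ℂ)) else 0)) -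
        (∑ m ∈ dyadic M, ∑ n ∈ dyadic N,
          (if (m * n).Coprime q then ((α m : ℂ) * (β n : ℂ)) else 0)) / (Nat.totient q : ℂ) := by
    unfold bilinDisc
    simp only [Complex.ofReal_sum, Complex.ofReal_sub, Complex.ofReal_div, Complex.ofReal_natCast,
      apply_ite Complex.ofReal, Complex.ofReal_mul, Complex.ofReal_zero]
  have h3 : ((bilinDisc a M N α β q : ℝ) : ℂ) =
      (Nat.totient q : ℂ)⁻¹ * ∑ χ : DirichletCharacter ℂ q,
        if χ = 1 then 0 else χ (u : ZMod q)⁻¹ * (Sα χ * Sβ χ) := by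
    rw [hcast, h1, hsplit, h2, div_eq_inv_mul]
    ring
  -- norms
  rw [← Real.norm_eq_abs, ← Complex.norm_real, h3, norm_mul, norm_inv, Complex.norm_natCast]
  refine mul_le_mul_of_nonneg_left ((norm_sum_le _ _).trans (Finset.sum_le_sum fun χ _ => ?_))
    (inv_nonneg.2 hφpos.le)
  split_ifs with hχ
  · simp
  · rw [norm_mul, norm_mul]
    exact mul_le_of_le_one_left (by positivity) (χ.norm_le_one _)

/-! ### Step 2: reduction to primitive characters (BFI p. 212: "We reduce to primitive characters
as in (a)": `∑_n β_n χ(n) = ∑_{(n,e)=1} β_n ψ(n)` for `χ mod q = fe` induced by `ψ mod f`) -/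

open scoped Classical in
/-- **Reduction to primitive characters.**  Each `χ ≠ χ₀ (mod q)` is induced by a primitive
`ψ (mod d)`, `d ∣ q`, `d > 1`, and then `∑_m α_m χ(m) = ∑_{(m, q/d) = 1} α_m ψ(m)` (BFI p. 212);
summing over the index set `S(q) = {(d, ψ)}` (`Literature.NumberTheory.Sieve.primIndex`) only
enlarges the sum. [cite: BombieriFriedlanderIwaniecActa1986, §2 p. 212] -/
theorem sum_char_le_sum_primIndex_coprime (q : ℕ) [NeZero q] (M N : ℝ) (α β : ℕ → ℝ) :
    (∑ χ : DirichletCharacter ℂ q, if χ = 1 then 0 else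
        ‖∑ m ∈ dyadic M, (α m : ℂ) * χ m‖ * ‖∑ n ∈ dyadic N, (β n : ℂ) * χ n‖) ≤
      ∑ t ∈ primIndex q, if t.1 = 1 then 0 else
        ‖∑ m ∈ dyadic M, (if m.Coprime (q / t.1) then (α m : ℂ) else 0) * t.2 m‖ *
          ‖∑ n ∈ dyadic N, (if n.Coprime (q / t.1) then (β n : ℂ) else 0) * t.2 n‖ := by
  refine (sum_le_sum_primIndex q fun χ => ?_).trans (Finset.sum_le_sum fun t ht => ?_)
  · split_ifs <;> positivity
  obtain ⟨hdq, -, -⟩ := mem_primIndex.1 ht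
  rw [induce, dif_pos hdq]
  by_cases hd : t.1 = 1
  · rw [if_pos hd, DirichletCharacter.level_one' t.2 hd, DirichletCharacter.changeLevel_one,
      if_pos rfl]
  rw [if_neg hd]
  -- the restricted character sums
  have hkey : ∀ (γ : ℕ → ℝ) (m : ℕ),
      (γ m : ℂ) * DirichletCharacter.changeLevel hdq t.2 (m : ZMod q) =
        (if m.Coprime (q / t.1) then (γ m : ℂ) else 0) * t.2 (m : ZMod t.1) := by
    intro γ m
    by_cases hmq : m.Coprime q
    · have h1 : DirichletCharacter.changeLevel hdq t.2 (m : ZMod q) = t.2 (m : ZMod t.1) := by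
        have := DirichletCharacter.changeLevel_eq_cast_of_dvd' t.2 hdq (a := (m : ℤ))
          (Nat.isCoprime_iff_coprime.2 hmq)
        simpa only [Int.cast_natCast] using this
      rw [h1, if_pos (hmq.coprime_dvd_right (Nat.div_dvd_of_dvd hdq))]
    · rw [MulChar.map_nonunit _ (mt (ZMod.isUnit_iff_coprime m q).1 hmq), mul_zero]
      by_cases hme : m.Coprime (q / t.1)
      · have hmd : ¬ m.Coprime t.1 := by
          intro hmd
          apply hmq
          have := Nat.Coprime.mul_right hmd hme
          rwa [Nat.mul_div_cancel' hdq] at this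
        rw [MulChar.map_nonunit _ (mt (ZMod.isUnit_iff_coprime m t.1).1 hmd), mul_zero]
      · rw [if_neg hme, zero_mul]
  have hSα : ∑ m ∈ dyadic M, (α m : ℂ) * DirichletCharacter.changeLevel hdq t.2 m =
      ∑ m ∈ dyadic M, (if m.Coprime (q / t.1) then (α m : ℂ) else 0) * t.2 m :=
    Finset.sum_congr rfl fun m _ => hkey α m
  have hSβ : ∑ n ∈ dyadic N, (β n : ℂ) * DirichletCharacter.changeLevel hdq t.2 n =
      ∑ n ∈ dyadic N, (if n.Coprime (q / t.1) then (β n : ℂ) else 0) * t.2 n :=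
    Finset.sum_congr rfl fun n _ => hkey β n
  rw [hSα, hSβ]
  split_ifs
  · positivity
  · exact le_rfl

/-! ### Step 3: from `∑_q φ(q)⁻¹ ∑_{d ∣ q}` to `∑_e φ(e)⁻¹ ∑_d φ(d)⁻¹` (BFI p. 212:
"`φ(fe) ≥ φ(f) φ(e)`") -/

/-- **Swapping the moduli**: writing `q = d e` and using `φ(de) ≥ φ(d) φ(e)`,
`∑_{q ≤ Q} φ(q)⁻¹ ∑_{d ∣ q} H(d, q/d) ≤ ∑_{e ≤ Q} φ(e)⁻¹ ∑_{d ≤ Q} φ(d)⁻¹ H(d, e)` for `H ≥ 0`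
(BFI p. 212, the display defining `S_e`). [cite: BombieriFriedlanderIwaniecActa1986, §2 p. 212] -/
theorem sum_inv_totient_mul_sum_divisors_le (Q : ℕ) (H : ℕ → ℕ → ℝ) (hH : ∀ d e, 0 ≤ H d e) :
    ∑ q ∈ Icc 1 Q, (Nat.totient q : ℝ)⁻¹ * ∑ d ∈ q.divisors, H d (q / d) ≤
      ∑ e ∈ Icc 1 Q, (Nat.totient e : ℝ)⁻¹ *
        ∑ d ∈ Icc 1 Q, (Nat.totient d : ℝ)⁻¹ * H d e := by
  calc ∑ q ∈ Icc 1 Q, (Nat.totient q : ℝ)⁻¹ * ∑ d ∈ q.divisors, H d (q / d)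
      = ∑ d ∈ Icc 1 Q, ∑ q ∈ Icc 1 Q with d ∣ q, (Nat.totient q : ℝ)⁻¹ * H d (q / d) := by
        simp_rw [Finset.mul_sum]
        rw [Finset.sum_comm' (t' := Icc 1 Q) (s' := fun d => (Icc 1 Q).filter (d ∣ ·))]
        intro q d
        simp only [Finset.mem_Icc, Nat.mem_divisors, Finset.mem_filter]
        constructor
        · rintro ⟨⟨hq1, hqQ⟩, hdq, hq0⟩
          exact ⟨⟨⟨hq1, hqQ⟩, hdq⟩, Nat.pos_of_dvd_of_pos hdq hq1,
            (Nat.le_of_dvd hq1 hdq).trans hqQ⟩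
        · rintro ⟨⟨⟨hq1, hqQ⟩, hdq⟩, hd1, hdQ⟩
          exact ⟨⟨hq1, hqQ⟩, hdq, by omega⟩
    _ ≤ ∑ d ∈ Icc 1 Q, ∑ e ∈ Icc 1 Q, (Nat.totient (d * e) : ℝ)⁻¹ * H d e := by
        refine Finset.sum_le_sum fun d hd => ?_
        have hd1 : 1 ≤ d := (Finset.mem_Icc.1 hd).1
        refine (sum_filter_dvd_le Q hd1 (g := fun q => (Nat.totient q : ℝ)⁻¹ * H d (q / d))
          fun n => mul_nonneg (inv_nonneg.2 (Nat.cast_nonneg _)) (hH _ _)).trans (le_of_eq ?_)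
        refine Finset.sum_congr rfl fun e _ => ?_
        simp only [Nat.mul_div_cancel_left e hd1]
    _ ≤ ∑ d ∈ Icc 1 Q, ∑ e ∈ Icc 1 Q,
          (Nat.totient d : ℝ)⁻¹ * (Nat.totient e : ℝ)⁻¹ * H d e := by
        refine Finset.sum_le_sum fun d hd => Finset.sum_le_sum fun e he =>
          mul_le_mul_of_nonneg_right ?_ (hH d e)
        rw [← mul_inv]
        have hd1 : 1 ≤ d := (Finset.mem_Icc.1 hd).1
        have he1 : 1 ≤ e := (Finset.mem_Icc.1 he).1
        have h0 : 0 < (Nat.totient d : ℝ) * Nat.totient e := by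
          have := Nat.totient_pos.2 hd1; have := Nat.totient_pos.2 he1; positivity
        exact inv_anti₀ h0 (by exact_mod_cast Nat.totient_super_multiplicative d e)
    _ = _ := by
        rw [Finset.sum_comm]
        refine Finset.sum_congr rfl fun e _ => ?_
        rw [Finset.mul_sum]
        refine Finset.sum_congr rfl fun d _ => ?_
        ring

/-! ### Step 4: small conductors — the Siegel–Walfisz hypothesis (A₂) (BFI p. 212: "For
`2 ≤ f ≤ F` we split into progressions (mod f) and apply (A₂)") -/

/-- **(A₂) bounds character sums to small moduli**: for `ψ ≠ χ₀ (mod d)`, `e ≥ 1` and `β` with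
(A₂) (`Literature.NumberTheory.Sieve.BFI.SiegelWalfiszHyp`),
`|∑_{n ∼ N, (n,e)=1} β_n ψ(n)| ≤ φ(d) · C(A') ‖β‖ N^{1/2} τ(e)^B (log 2N)^{−A'}` — split into the
reduced classes `u (mod d)`, subtract the common main term using `∑_u ψ(u) = 0`, and apply (A₂) to
each class (BFI p. 212: "`∑_{(n,e)=1} β_n ψ(n) ≪ ‖β‖ N^{1/2} (log N)^{−A'} τ^B(e) f`").
[cite: BombieriFriedlanderIwaniecActa1986, §2 p. 212] -/
theorem norm_sum_coprime_mul_char_le_of_SW {N B : ℝ} {Csw : ℝ → ℝ} {β : ℕ → ℝ}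
    (hβ : SiegelWalfiszHyp N B Csw β) {A' : ℝ} (hA' : 0 < A') {d : ℕ} [NeZero d]
    {ψ : DirichletCharacter ℂ d} (hψ : ψ ≠ 1) {e : ℕ} (he : 1 ≤ e) :
    ‖∑ n ∈ dyadic N, (if n.Coprime e then (β n : ℂ) else 0) * ψ n‖ ≤
      (Nat.totient d : ℝ) * (Csw A' * Real.sqrt (l2Sq N β) * N ^ (1 / 2 : ℝ) * (σ 0 e : ℝ) ^ B /
        Real.log (2 * N) ^ A') := by
  have hd1 : 1 ≤ d := NeZero.one_le
  -- expand `ψ(n)` over the reduced classes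
  have hexp : ∀ n : ℕ, ψ (n : ZMod d) =
      ∑ u : (ZMod d)ˣ, if (n : ZMod d) = (u : ZMod d) then ψ (u : ZMod d) else 0 := by
    intro n
    by_cases hn : IsUnit (n : ZMod d)
    · obtain ⟨u₀, hu₀⟩ := hn
      rw [← hu₀, Finset.sum_eq_single u₀]
      · rw [if_pos rfl]
      · intro u _ hu
        rw [if_neg]
        exact fun h => hu (Units.val_injective h.symm)
      · intro h; exact absurd (Finset.mem_univ u₀) h
    · rw [MulChar.map_nonunit _ hn]
      symm
      refine Finset.sum_eq_zero fun u _ => ?_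
      rw [if_neg]
      intro h
      exact hn (by rw [h]; exact u.isUnit)
  -- the class sums and the main term
  set R : ℝ := Csw A' * Real.sqrt (l2Sq N β) * N ^ (1 / 2 : ℝ) * (σ 0 e : ℝ) ^ B /
    Real.log (2 * N) ^ A' with hR
  set Y : ℝ := (∑ n ∈ dyadic N, if n.Coprime (e * d) then β n else 0) / (Nat.totient d : ℝ)
    with hY
  set X : (ZMod d)ˣ → ℝ := fun u =>
    ∑ n ∈ dyadic N, if (n : ZMod d) = (u : ZMod d) ∧ n.Coprime e then β n else 0 with hX
  have hXu : ∀ u : (ZMod d)ˣ, |X u - Y| ≤ R := by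
    intro u
    have hl : IsCoprime (d : ℤ) (((u : ZMod d).val : ℕ) : ℤ) :=
      (Nat.isCoprime_iff_coprime.2 (ZMod.val_coe_unit_coprime u)).symm
    have h := hβ A' hA' e d he hd1 _ hl
    have hcast : (((((u : ZMod d).val : ℕ) : ℤ) : ZMod d)) = (u : ZMod d) := by
      rw [Int.cast_natCast, ZMod.natCast_zmod_val]
    simp only [hcast] at h
    exact h
  -- the character sum in terms of the class sums
  have hS : ∑ n ∈ dyadic N, (if n.Coprime e then (β n : ℂ) else 0) * ψ n =
      ∑ u : (ZMod d)ˣ, ψ (u : ZMod d) * ((X u : ℝ) : ℂ) := by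
    simp_rw [hexp, Finset.mul_sum]
    rw [Finset.sum_comm]
    refine Finset.sum_congr rfl fun u _ => ?_
    simp only [hX, Complex.ofReal_sum, apply_ite Complex.ofReal, Complex.ofReal_zero,
      Finset.mul_sum]
    refine Finset.sum_congr rfl fun n _ => ?_
    by_cases h1 : (n : ZMod d) = (u : ZMod d) <;> by_cases h2 : n.Coprime e <;>
      simp [h1, h2, mul_comm]
  have hS' : ∑ n ∈ dyadic N, (if n.Coprime e then (β n : ℂ) else 0) * ψ n =
      ∑ u : (ZMod d)ˣ, ψ (u : ZMod d) * (((X u - Y : ℝ)) : ℂ) := by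
    rw [hS]
    have : ∑ u : (ZMod d)ˣ, ψ (u : ZMod d) * (((X u - Y : ℝ)) : ℂ) =
        ∑ u : (ZMod d)ˣ, ψ (u : ZMod d) * ((X u : ℝ) : ℂ) -
          (∑ u : (ZMod d)ˣ, ψ (u : ZMod d)) * (Y : ℂ) := by
      rw [Finset.sum_mul, ← Finset.sum_sub_distrib]
      refine Finset.sum_congr rfl fun u _ => ?_
      push_cast
      ring
    rw [this, sum_units_eq_zero_of_ne_one hψ, zero_mul, sub_zero]
  rw [hS']
  calc ‖∑ u : (ZMod d)ˣ, ψ (u : ZMod d) * (((X u - Y : ℝ)) : ℂ)‖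
      ≤ ∑ u : (ZMod d)ˣ, ‖ψ (u : ZMod d) * (((X u - Y : ℝ)) : ℂ)‖ := norm_sum_le _ _
    _ ≤ ∑ u : (ZMod d)ˣ, R := Finset.sum_le_sum fun u _ => by
        rw [norm_mul, Complex.norm_real, Real.norm_eq_abs]
        exact (mul_le_of_le_one_left (abs_nonneg _) (ψ.norm_le_one _)).trans (hXu u)
    _ = (Nat.totient d : ℝ) * R := by
        rw [Finset.sum_const, Finset.card_univ, ZMod.card_units_eq_totient, nsmul_eq_mul]

/-! ### Step 5: large conductors — the large sieve on dyadic blocks (BFI p. 213: "We split the sum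
`T_e(f > F)` into intervals `V < f ≤ 2V` … apply Cauchy's inequality … (1.6) to both sums") -/

open scoped Classical in
/-- **One dyadic block of `T_e(f > F)`** (BFI (2.7), p. 213): for `V ≥ 1` and any complex
coefficients `a_m` (`m ∼ M`), `b_n` (`n ∼ N`),
`∑_{V < d ≤ 2V} φ(d)⁻¹ ∑*_{ψ mod d} |∑_m a_m ψ(m)| |∑_n b_n ψ(n)|
  ≤ V⁻¹ ((M + 2 + 8V²) ∑|a_m|²)^{1/2} ((N + 2 + 8V²) ∑|b_n|²)^{1/2}`,
from `φ(d)⁻¹ ≤ V⁻¹ d/φ(d)` and the bilinear large sieve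
(`Literature.NumberTheory.Sieve.LargeSieve.largeSieve_bilinear`, moduli `≤ 2V`).
[cite: BombieriFriedlanderIwaniecActa1986, §2 (2.7) p. 213] -/
theorem sum_Ioc_inv_totient_mul_le (a b : ℕ → ℂ) {M N : ℝ} (hM : 0 ≤ M) (hN : 0 ≤ N) {V : ℕ}
    (hV : 1 ≤ V) :
    ∑ d ∈ Ioc V (2 * V), (Nat.totient d : ℝ)⁻¹ *
        ∑ ψ : DirichletCharacter ℂ d with ψ.IsPrimitive,
          ‖∑ m ∈ dyadic M, a m * ψ m‖ * ‖∑ n ∈ dyadic N, b n * ψ n‖ ≤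
      (V : ℝ)⁻¹ * (Real.sqrt ((M + 2 + 8 * (V : ℝ) ^ 2) * ∑ m ∈ dyadic M, ‖a m‖ ^ 2) *
        Real.sqrt ((N + 2 + 8 * (V : ℝ) ^ 2) * ∑ n ∈ dyadic N, ‖b n‖ ^ 2)) := by
  obtain ⟨hMI, hM'⟩ := dyadic_eq_Ioc_add hM
  obtain ⟨hNI, hN'⟩ := dyadic_eq_Ioc_add hN
  set M₀ := ⌊M⌋₊ with hM₀
  set M' := ⌊2 * M⌋₊ - ⌊M⌋₊ with hM'def
  set N₀ := ⌊N⌋₊ with hN₀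
  set N' := ⌊2 * N⌋₊ - ⌊N⌋₊ with hN'def
  -- the product as a bilinear sum
  have hfac : ∀ (d : ℕ) (ψ : DirichletCharacter ℂ d),
      ‖∑ m ∈ dyadic M, a m * ψ m‖ * ‖∑ n ∈ dyadic N, b n * ψ n‖ =
        ‖∑ m ∈ Ioc M₀ (M₀ + M'), ∑ n ∈ Ioc N₀ (N₀ + N'), a m * b n * ψ (m * n)‖ := by
    intro d ψ
    rw [← norm_mul, hMI, hNI, Finset.sum_mul_sum]
    congr 1
    refine Finset.sum_congr rfl fun m _ => Finset.sum_congr rfl fun n _ => ?_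
    rw [map_mul]
    ring
  have hV0 : (0 : ℝ) < V := by exact_mod_cast hV
  have hw : ∀ d ∈ Ioc V (2 * V),
      (Nat.totient d : ℝ)⁻¹ ≤ (V : ℝ)⁻¹ * ((d : ℝ) / Nat.totient d) := by
    intro d hd
    rw [Finset.mem_Ioc] at hd
    have hd0 : (0 : ℝ) < d := by exact_mod_cast lt_of_le_of_lt (Nat.zero_le V) hd.1
    have hφ : (0 : ℝ) < Nat.totient d := by exact_mod_cast Nat.totient_pos.2 (by omega)
    calc (Nat.totient d : ℝ)⁻¹ = (d : ℝ)⁻¹ * ((d : ℝ) / Nat.totient d) := by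
          field_simp
      _ ≤ (V : ℝ)⁻¹ * ((d : ℝ) / Nat.totient d) :=
          mul_le_mul_of_nonneg_right (inv_anti₀ hV0 (by exact_mod_cast hd.1.le)) (by positivity)
  have hnn : ∀ d : ℕ, 0 ≤ ∑ ψ : DirichletCharacter ℂ d with ψ.IsPrimitive,
      ‖∑ m ∈ dyadic M, a m * ψ m‖ * ‖∑ n ∈ dyadic N, b n * ψ n‖ :=
    fun d => Finset.sum_nonneg fun _ _ => by positivity
  have hLS := LargeSieve.largeSieve_bilinear a b M₀ M' N₀ N' (2 * V)
  calc ∑ d ∈ Ioc V (2 * V), (Nat.totient d : ℝ)⁻¹ *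
        ∑ ψ : DirichletCharacter ℂ d with ψ.IsPrimitive,
          ‖∑ m ∈ dyadic M, a m * ψ m‖ * ‖∑ n ∈ dyadic N, b n * ψ n‖
      ≤ ∑ d ∈ Ioc V (2 * V), (V : ℝ)⁻¹ * (((d : ℝ) / Nat.totient d) *
        ∑ ψ : DirichletCharacter ℂ d with ψ.IsPrimitive,
          ‖∑ m ∈ dyadic M, a m * ψ m‖ * ‖∑ n ∈ dyadic N, b n * ψ n‖) :=
        Finset.sum_le_sum fun d hd => by
          rw [← mul_assoc]
          exact mul_le_mul_of_nonneg_right (hw d hd) (hnn d)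
    _ = (V : ℝ)⁻¹ * ∑ d ∈ Ioc V (2 * V), ((d : ℝ) / Nat.totient d) *
        ∑ ψ : DirichletCharacter ℂ d with ψ.IsPrimitive,
          ‖∑ m ∈ dyadic M, a m * ψ m‖ * ‖∑ n ∈ dyadic N, b n * ψ n‖ := by
        rw [Finset.mul_sum]
    _ ≤ (V : ℝ)⁻¹ * ∑ d ∈ Icc 1 (2 * V), ((d : ℝ) / Nat.totient d) *
        ∑ ψ : DirichletCharacter ℂ d with ψ.IsPrimitive,
          ‖∑ m ∈ dyadic M, a m * ψ m‖ * ‖∑ n ∈ dyadic N, b n * ψ n‖ := by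
        refine mul_le_mul_of_nonneg_left (Finset.sum_le_sum_of_subset_of_nonneg ?_
          fun d _ _ => mul_nonneg (by positivity) (hnn d)) (inv_nonneg.2 hV0.le)
        intro d hd
        rw [Finset.mem_Ioc] at hd
        rw [Finset.mem_Icc]
        omega
    _ ≤ (V : ℝ)⁻¹ * (Real.sqrt (((M' : ℝ) + 1 + 2 * ((2 * V : ℕ) : ℝ) ^ 2) *
          ∑ m ∈ Ioc M₀ (M₀ + M'), ‖a m‖ ^ 2) *
        Real.sqrt (((N' : ℝ) + 1 + 2 * ((2 * V : ℕ) : ℝ) ^ 2) *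
          ∑ n ∈ Ioc N₀ (N₀ + N'), ‖b n‖ ^ 2)) := by
        refine mul_le_mul_of_nonneg_left ?_ (inv_nonneg.2 hV0.le)
        simp_rw [hfac]
        exact hLS
    _ ≤ _ := by
        rw [← hMI, ← hNI]
        have e1 : (M' : ℝ) + 1 + 2 * ((2 * V : ℕ) : ℝ) ^ 2 ≤ M + 2 + 8 * (V : ℝ) ^ 2 := by
          push_cast; nlinarith [hM']
        have e2 : (N' : ℝ) + 1 + 2 * ((2 * V : ℕ) : ℝ) ^ 2 ≤ N + 2 + 8 * (V : ℝ) ^ 2 := by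
          push_cast; nlinarith [hN']
        gcongr

/-- **Dyadic decomposition**: for `g ≥ 0` and `Qn ≤ F·2^K`,
`∑_{F < d ≤ Qn} g(d) ≤ ∑_{k < K} ∑_{F2^k < d ≤ 2F2^k} g(d)`. [folklore] -/
theorem sum_Ioc_le_sum_dyadicBlocks {g : ℕ → ℝ} (hg : ∀ d, 0 ≤ g d) (F K Qn : ℕ)
    (hK : Qn ≤ F * 2 ^ K) :
    ∑ d ∈ Ioc F Qn, g d ≤ ∑ k ∈ Finset.range K, ∑ d ∈ Ioc (F * 2 ^ k) (2 * (F * 2 ^ k)), g d := by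
  have hcover : ∀ K : ℕ, ∑ d ∈ Ioc F (F * 2 ^ K), g d =
      ∑ k ∈ Finset.range K, ∑ d ∈ Ioc (F * 2 ^ k) (2 * (F * 2 ^ k)), g d := by
    intro K
    induction K with
    | zero => simp
    | succ K ih =>
      rw [Finset.sum_range_succ, ← ih, show 2 * (F * 2 ^ K) = F * 2 ^ (K + 1) by ring]
      exact (Finset.sum_Ioc_consecutive _ (Nat.le_mul_of_pos_right _ (by positivity))
        (Nat.mul_le_mul_left _ (Nat.pow_le_pow_right (by norm_num) (Nat.le_succ K)))).symm
  rw [← hcover]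
  exact Finset.sum_le_sum_of_subset_of_nonneg (Finset.Ioc_subset_Ioc_right hK) fun _ _ _ => hg _

open scoped Classical in
/-- **`T_e(f > F)`** (BFI (2.7), p. 213: "`T_e(f > F) ≪ (log² Q) ‖α‖ ‖β‖ sup_V V⁻¹ (V² + M)^{1/2}
(V² + N)^{1/2} ≪ … (Q + M^{1/2} + N^{1/2} + M^{1/2} N^{1/2} F⁻¹)`"), with explicit constants: for
`F ≥ 1`, `Qn ≤ F·2^K`,
`∑_{F < d ≤ Qn} φ(d)⁻¹ ∑*_ψ |∑_m a_m ψ(m)| |∑_n b_n ψ(n)|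
  ≤ (2 √(M+2) √(N+2) / F + 3K (√(M+2) + √(N+2)) + 9 F 2^K) ‖a‖ ‖b‖`.
[cite: BombieriFriedlanderIwaniecActa1986, §2 (2.7) p. 213] -/
theorem sum_Ioc_inv_totient_mul_le_of_dyadic (a b : ℕ → ℂ) {M N : ℝ} (hM : 0 ≤ M) (hN : 0 ≤ N)
    {F : ℕ} (hF : 1 ≤ F) (K Qn : ℕ) (hK : Qn ≤ F * 2 ^ K) :
    ∑ d ∈ Ioc F Qn, (Nat.totient d : ℝ)⁻¹ *
        ∑ ψ : DirichletCharacter ℂ d with ψ.IsPrimitive,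
          ‖∑ m ∈ dyadic M, a m * ψ m‖ * ‖∑ n ∈ dyadic N, b n * ψ n‖ ≤
      (2 * Real.sqrt (M + 2) * Real.sqrt (N + 2) / F +
          3 * K * (Real.sqrt (M + 2) + Real.sqrt (N + 2)) + 9 * F * 2 ^ K) *
        (Real.sqrt (∑ m ∈ dyadic M, ‖a m‖ ^ 2) * Real.sqrt (∑ n ∈ dyadic N, ‖b n‖ ^ 2)) := by
  set SA := Real.sqrt (∑ m ∈ dyadic M, ‖a m‖ ^ 2) with hSA
  set SB := Real.sqrt (∑ n ∈ dyadic N, ‖b n‖ ^ 2) with hSB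
  set P := Real.sqrt (M + 2) with hP
  set R := Real.sqrt (N + 2) with hR
  set g : ℕ → ℝ := fun d => (Nat.totient d : ℝ)⁻¹ *
    ∑ ψ : DirichletCharacter ℂ d with ψ.IsPrimitive,
      ‖∑ m ∈ dyadic M, a m * ψ m‖ * ‖∑ n ∈ dyadic N, b n * ψ n‖ with hg
  have hg0 : ∀ d, 0 ≤ g d := fun d =>
    mul_nonneg (inv_nonneg.2 (Nat.cast_nonneg _)) (Finset.sum_nonneg fun _ _ => by positivity)
  have hF0 : (0 : ℝ) < F := by exact_mod_cast hF
  have hSA0 : 0 ≤ SA := Real.sqrt_nonneg _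
  have hSB0 : 0 ≤ SB := Real.sqrt_nonneg _
  have hP0 : 0 ≤ P := Real.sqrt_nonneg _
  have hR0 : 0 ≤ R := Real.sqrt_nonneg _
  -- each block
  have hblock : ∀ k ∈ Finset.range K, ∑ d ∈ Ioc (F * 2 ^ k) (2 * (F * 2 ^ k)), g d ≤
      (P * R / ((F : ℝ) * 2 ^ k) + 3 * (P + R) + 9 * ((F : ℝ) * 2 ^ k)) * (SA * SB) := by
    intro k _
    have hV : 1 ≤ F * 2 ^ k := Nat.one_le_iff_ne_zero.2 (by positivity)
    refine (sum_Ioc_inv_totient_mul_le a b hM hN hV).trans ?_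
    have hV0 : (0 : ℝ) < ((F * 2 ^ k : ℕ) : ℝ) := by positivity
    set V : ℝ := ((F * 2 ^ k : ℕ) : ℝ) with hVdef
    have hVF : V = (F : ℝ) * 2 ^ k := by rw [hVdef]; push_cast; ring
    rw [Real.sqrt_mul (by positivity), Real.sqrt_mul (by positivity)]
    have hPsq : P ^ 2 = M + 2 := Real.sq_sqrt (by positivity)
    have hRsq : R ^ 2 = N + 2 := Real.sq_sqrt (by positivity)
    have h1 : Real.sqrt (M + 2 + 8 * V ^ 2) ≤ P + 3 * V := by
      rw [Real.sqrt_le_left (by positivity)]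
      nlinarith [mul_nonneg hP0 hV0.le, sq_nonneg V]
    have h2 : Real.sqrt (N + 2 + 8 * V ^ 2) ≤ R + 3 * V := by
      rw [Real.sqrt_le_left (by positivity)]
      nlinarith [mul_nonneg hR0 hV0.le, sq_nonneg V]
    calc V⁻¹ * (Real.sqrt (M + 2 + 8 * V ^ 2) * SA * (Real.sqrt (N + 2 + 8 * V ^ 2) * SB))
        ≤ V⁻¹ * ((P + 3 * V) * SA * ((R + 3 * V) * SB)) := by gcongr
      _ = (P * R / V + 3 * (P + R) + 9 * V) * (SA * SB) := by
          field_simp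
          ring
      _ = _ := by rw [hVF]
  -- summing the blocks
  refine (sum_Ioc_le_sum_dyadicBlocks hg0 F K Qn hK).trans ?_
  refine (Finset.sum_le_sum hblock).trans ?_
  rw [← Finset.sum_mul]
  refine mul_le_mul_of_nonneg_right ?_ (mul_nonneg hSA0 hSB0)
  rw [Finset.sum_add_distrib, Finset.sum_add_distrib, Finset.sum_const, Finset.card_range,
    nsmul_eq_mul]
  have hgeom1 : ∑ k ∈ Finset.range K, P * R / ((F : ℝ) * 2 ^ k) ≤ 2 * P * R / F := by
    have : ∀ k : ℕ, P * R / ((F : ℝ) * 2 ^ k) = P * R / F * (1 / 2 : ℝ) ^ k := fun k => by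
      rw [one_div_pow]; field_simp
    simp_rw [this]
    rw [← Finset.mul_sum]
    have hg : ∑ k ∈ Finset.range K, (1 / 2 : ℝ) ^ k ≤ 2 := by
      rw [Finset.range_eq_Ico]
      refine (geom_sum_Ico_le_of_lt_one (by norm_num) (by norm_num)).trans ?_
      norm_num
    calc P * R / F * ∑ k ∈ Finset.range K, (1 / 2 : ℝ) ^ k ≤ P * R / F * 2 :=
          mul_le_mul_of_nonneg_left hg (by positivity)
      _ = 2 * P * R / F := by ring
  have hgeom2 : ∑ k ∈ Finset.range K, 9 * ((F : ℝ) * 2 ^ k) ≤ 9 * F * 2 ^ K := by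
    rw [← Finset.mul_sum, ← Finset.mul_sum, geom_sum_eq (by norm_num : (2 : ℝ) ≠ 1) K, mul_assoc]
    refine mul_le_mul_of_nonneg_left (mul_le_mul_of_nonneg_left ?_ hF0.le) (by norm_num)
    norm_num
  have hmid : (K : ℝ) * (3 * (P + R)) = 3 * K * (P + R) := by ring
  linarith

/-! ### Step 6: assembling (2.4), (2.6), (2.7) -/

/-- (A₂) with each constant `C(A)` replaced by its positive part `max (C(A), 0)` (for `N ≥ 1`, so
that `log 2N > 0`). [folklore] -/
theorem SiegelWalfiszHyp.pos_part {N B : ℝ} {Csw : ℝ → ℝ} {β : ℕ → ℝ}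
    (hβ : SiegelWalfiszHyp N B Csw β) (hN : 1 ≤ N) :
    SiegelWalfiszHyp N B (fun A => max (Csw A) 0) β := by
  intro A hA d k hd hk l hl
  have hlog : 0 < Real.log (2 * N) ^ A := Real.rpow_pos_of_pos (Real.log_pos (by linarith)) _
  refine (hβ A hA d k hd hk l hl).trans (div_le_div_of_nonneg_right ?_ hlog.le)
  exact mul_le_mul_of_nonneg_right (mul_le_mul_of_nonneg_right (mul_le_mul_of_nonneg_right
    (le_max_left _ _) (Real.sqrt_nonneg _)) (by positivity)) (by positivity)

open scoped Classical in
/-- **The skeleton of the proof of Theorem 0 (b)** (BFI pp. 212–213, (2.4)–(2.7)), with every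
constant explicit and before the choice of the parameters: for `M ≥ 0`, `N ≥ 1`, `β` with (A₂)
(constant `C(A') ≥ 0`), arbitrary real `α`, residues `a_q` with `(q, a_q) = 1`, and natural numbers
`F ≥ 1`, `K`, `Qn ≤ F·2^K`,
`∑_{q ≤ Qn} |Δ_{α⋆β}(q, a_q)|
  ≤ [C(A') ‖β‖ N^{1/2} (log 2N)^{−A'}] F² (M+1)^{1/2} ‖α‖ ∑_{e ≤ Qn} τ(e)^B/φ(e)
  + [2 √(M+2) √(N+2)/F + 3K (√(M+2) + √(N+2)) + 9 F 2^K] ‖α‖ ‖β‖ ∑_{e ≤ Qn} 1/φ(e)`: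
orthogonality and the reduction to primitive characters (`T ≤ ∑_e φ(e)⁻¹ (T_e(f ≤ F) + T_e(f > F))`,
(2.4)), (A₂) on `T_e(f ≤ F)` ((2.6), here with the trivial bound `F²(M+1)^{1/2}‖α‖` on the
`α`-side in place of the large sieve), and the large sieve on dyadic blocks for `T_e(f > F)`
((2.7)).
[cite: BombieriFriedlanderIwaniecActa1986, §2 (2.4)–(2.7) pp. 212–213] -/
theorem sum_abs_bilinDisc_le_main {M N B : ℝ} {Csw : ℝ → ℝ} {α β : ℕ → ℝ}
    (hM : 0 ≤ M) (hN : 1 ≤ N) (hβ : SiegelWalfiszHyp N B Csw β) {A' : ℝ} (hA' : 0 < A')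
    (hC : 0 ≤ Csw A') {F : ℕ} (hF : 1 ≤ F) (K Qn : ℕ) (hK : Qn ≤ F * 2 ^ K)
    (a : ℕ → ℤ) (ha : ∀ q : ℕ, IsCoprime (q : ℤ) (a q)) :
    ∑ q ∈ Icc 1 Qn, |bilinDisc (a q) M N α β q| ≤
      (Csw A' * Real.sqrt (l2Sq N β) * N ^ (1 / 2 : ℝ) / Real.log (2 * N) ^ A') *
          (F : ℝ) ^ 2 * (Real.sqrt (M + 1) * Real.sqrt (l2Sq M α)) *
          ∑ e ∈ Icc 1 Qn, (σ 0 e : ℝ) ^ B / (Nat.totient e : ℝ) +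
        (2 * Real.sqrt (M + 2) * Real.sqrt (N + 2) / F +
            3 * K * (Real.sqrt (M + 2) + Real.sqrt (N + 2)) + 9 * F * 2 ^ K) *
          (Real.sqrt (l2Sq M α) * Real.sqrt (l2Sq N β)) *
          ∑ e ∈ Icc 1 Qn, (Nat.totient e : ℝ)⁻¹ := by
  have hN0 : 0 ≤ N := by linarith
  have hlog : 0 < Real.log (2 * N) ^ A' := Real.rpow_pos_of_pos (Real.log_pos (by linarith)) _
  -- notation
  set cα : ℕ → ℕ → ℂ := fun e m => if m.Coprime e then (α m : ℂ) else 0 with hcα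
  set cβ : ℕ → ℕ → ℂ := fun e n => if n.Coprime e then (β n : ℂ) else 0 with hcβ
  set H : ℕ → ℕ → ℝ := fun d e => ∑ ψ : DirichletCharacter ℂ d with ψ.IsPrimitive,
    if d = 1 then 0 else ‖∑ m ∈ dyadic M, cα e m * ψ m‖ * ‖∑ n ∈ dyadic N, cβ e n * ψ n‖
    with hH
  have hH0 : ∀ d e, 0 ≤ H d e := fun d e =>
    Finset.sum_nonneg fun _ _ => by split_ifs <;> positivity
  set Sα : ℝ := Real.sqrt (l2Sq M α) with hSαdef
  set Sβ : ℝ := Real.sqrt (l2Sq N β) with hSβdef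
  have hcαle : ∀ e, ∑ m ∈ dyadic M, ‖cα e m‖ ^ 2 ≤ l2Sq M α := by
    intro e
    unfold l2Sq
    refine Finset.sum_le_sum fun m _ => ?_
    simp only [hcα]
    split_ifs
    · rw [Complex.norm_real, Real.norm_eq_abs, sq_abs]
    · rw [norm_zero, zero_pow two_ne_zero]; positivity
  have hcβle : ∀ e, ∑ n ∈ dyadic N, ‖cβ e n‖ ^ 2 ≤ l2Sq N β := by
    intro e
    unfold l2Sq
    refine Finset.sum_le_sum fun n _ => ?_
    simp only [hcβ]
    split_ifs
    · rw [Complex.norm_real, Real.norm_eq_abs, sq_abs]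
    · rw [norm_zero, zero_pow two_ne_zero]; positivity
  -- Steps 1–3: `T ≤ ∑_e φ(e)⁻¹ ∑_d φ(d)⁻¹ H(d, e)`
  have hT : ∑ q ∈ Icc 1 Qn, |bilinDisc (a q) M N α β q| ≤
      ∑ e ∈ Icc 1 Qn, (Nat.totient e : ℝ)⁻¹ *
        ∑ d ∈ Icc 1 Qn, (Nat.totient d : ℝ)⁻¹ * H d e := by
    refine le_trans (Finset.sum_le_sum fun q hq => ?_)
      (sum_inv_totient_mul_sum_divisors_le Qn H hH0)
    have hq1 : 1 ≤ q := (Finset.mem_Icc.1 hq).1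
    haveI : NeZero q := ⟨by omega⟩
    refine (abs_bilinDisc_le_sum_char (ha q) M N α β).trans ?_
    refine mul_le_mul_of_nonneg_left ?_ (inv_nonneg.2 (Nat.cast_nonneg _))
    refine (sum_char_le_sum_primIndex_coprime q M N α β).trans (le_of_eq ?_)
    rw [primIndex, Finset.sum_sigma]
  -- per `e`: split at `F`
  have hsplit : ∀ e : ℕ, ∑ d ∈ Icc 1 Qn, (Nat.totient d : ℝ)⁻¹ * H d e ≤
      ∑ d ∈ Icc 1 F, (Nat.totient d : ℝ)⁻¹ * H d e +
        ∑ d ∈ Ioc F Qn, (Nat.totient d : ℝ)⁻¹ * H d e := by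
    intro e
    rw [← Finset.sum_union]
    · refine Finset.sum_le_sum_of_subset_of_nonneg ?_
        fun d _ _ => mul_nonneg (inv_nonneg.2 (Nat.cast_nonneg _)) (hH0 d e)
      intro d hd
      rw [Finset.mem_union, Finset.mem_Icc, Finset.mem_Ioc]
      rw [Finset.mem_Icc] at hd
      omega
    · rw [Finset.disjoint_left]
      intro d hd1 hd2
      rw [Finset.mem_Icc] at hd1
      rw [Finset.mem_Ioc] at hd2
      omega
  -- small moduli `d ≤ F`: (A₂)
  set Rβ : ℝ := Csw A' * Sβ * N ^ (1 / 2 : ℝ) / Real.log (2 * N) ^ A' with hRβ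
  have hαside : ∀ (e d : ℕ) (ψ : DirichletCharacter ℂ d),
      ‖∑ m ∈ dyadic M, cα e m * ψ m‖ ≤ Real.sqrt (M + 1) * Sα := by
    intro e d ψ
    refine (norm_sum_mul_char_le_sqrt_card ψ _ _).trans ?_
    exact mul_le_mul (Real.sqrt_le_sqrt (card_dyadic_le_add_one hM)) (Real.sqrt_le_sqrt (hcαle e))
      (Real.sqrt_nonneg _) (Real.sqrt_nonneg _)
  have hsmall : ∀ e ∈ Icc 1 Qn, ∑ d ∈ Icc 1 F, (Nat.totient d : ℝ)⁻¹ * H d e ≤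
      Rβ * (σ 0 e : ℝ) ^ B * (F : ℝ) ^ 2 * (Real.sqrt (M + 1) * Sα) := by
    intro e he
    have he1 : 1 ≤ e := (Finset.mem_Icc.1 he).1
    set Re : ℝ := Csw A' * Sβ * N ^ (1 / 2 : ℝ) * (σ 0 e : ℝ) ^ B / Real.log (2 * N) ^ A'
      with hRe
    have hRe0 : 0 ≤ Re := div_nonneg (by positivity) hlog.le
    have hReq : Re = Rβ * (σ 0 e : ℝ) ^ B := by rw [hRe, hRβ]; ring
    have hd_term : ∀ d ∈ Icc 1 F, (Nat.totient d : ℝ)⁻¹ * H d e ≤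
        (d : ℝ) * (Re * (Real.sqrt (M + 1) * Sα)) := by
      intro d hd
      have hd1 : 1 ≤ d := (Finset.mem_Icc.1 hd).1
      haveI : NeZero d := ⟨by omega⟩
      have hφ : (0 : ℝ) < Nat.totient d := by exact_mod_cast Nat.totient_pos.2 hd1
      by_cases hd1' : d = 1
      · have : H d e = 0 := by
          simp only [hH]
          exact Finset.sum_eq_zero fun _ _ => if_pos hd1'
        rw [this, mul_zero]
        positivity
      · have hψne : ∀ ψ : DirichletCharacter ℂ d, ψ.IsPrimitive → ψ ≠ 1 := by
          intro ψ hψ h1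
          rw [h1, DirichletCharacter.isPrimitive_def, DirichletCharacter.conductor_one] at hψ
          exact hd1' hψ.symm
        have h1 : H d e ≤ ∑ ψ : DirichletCharacter ℂ d with ψ.IsPrimitive,
            (Real.sqrt (M + 1) * Sα) * ((Nat.totient d : ℝ) * Re) := by
          simp only [hH, if_neg hd1']
          refine Finset.sum_le_sum fun ψ hψ => ?_
          have hψp : ψ.IsPrimitive := (Finset.mem_filter.1 hψ).2
          refine mul_le_mul (hαside e d ψ) ?_ (norm_nonneg _) (by positivity)
          exact norm_sum_coprime_mul_char_le_of_SW hβ hA' (hψne ψ hψp) he1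
        have hcard : (((Finset.univ : Finset (DirichletCharacter ℂ d)).filter
            (fun ψ : DirichletCharacter ℂ d => ψ.IsPrimitive)).card : ℝ) ≤ d := by
          have h := (Finset.card_filter_le (Finset.univ : Finset (DirichletCharacter ℂ d))
            (fun ψ : DirichletCharacter ℂ d => ψ.IsPrimitive)).trans_eq
            (Finset.card_univ (α := DirichletCharacter ℂ d))
          rw [← Nat.card_eq_fintype_card,
            DirichletCharacter.card_eq_totient_of_hasEnoughRootsOfUnity ℂ d] at h
          exact_mod_cast h.trans (Nat.totient_le d)
        calc (Nat.totient d : ℝ)⁻¹ * H d e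
            ≤ (Nat.totient d : ℝ)⁻¹ * ((((Finset.univ : Finset (DirichletCharacter ℂ d)).filter
                (fun ψ : DirichletCharacter ℂ d => ψ.IsPrimitive)).card : ℝ) *
                ((Real.sqrt (M + 1) * Sα) * ((Nat.totient d : ℝ) * Re))) := by
              refine mul_le_mul_of_nonneg_left (h1.trans_eq ?_) (inv_nonneg.2 hφ.le)
              rw [Finset.sum_const, nsmul_eq_mul]
          _ = (((Finset.univ : Finset (DirichletCharacter ℂ d)).filter
                (fun ψ : DirichletCharacter ℂ d => ψ.IsPrimitive)).card : ℝ) *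
                (Re * (Real.sqrt (M + 1) * Sα)) := by
              field_simp
          _ ≤ (d : ℝ) * (Re * (Real.sqrt (M + 1) * Sα)) :=
              mul_le_mul_of_nonneg_right hcard (by positivity)
    calc ∑ d ∈ Icc 1 F, (Nat.totient d : ℝ)⁻¹ * H d e
        ≤ ∑ d ∈ Icc 1 F, (d : ℝ) * (Re * (Real.sqrt (M + 1) * Sα)) := Finset.sum_le_sum hd_term
      _ = (∑ d ∈ Icc 1 F, (d : ℝ)) * (Re * (Real.sqrt (M + 1) * Sα)) := by rw [Finset.sum_mul]
      _ ≤ (F : ℝ) ^ 2 * (Re * (Real.sqrt (M + 1) * Sα)) := by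
          refine mul_le_mul_of_nonneg_right ?_ (by positivity)
          have h := Finset.sum_le_card_nsmul (Icc 1 F) (fun d : ℕ => (d : ℝ)) F
            (fun d hd => by exact_mod_cast (Finset.mem_Icc.1 hd).2)
          rw [Nat.card_Icc, Nat.add_sub_cancel, nsmul_eq_mul] at h
          calc ∑ d ∈ Icc 1 F, (d : ℝ) ≤ (F : ℝ) * F := h
            _ = (F : ℝ) ^ 2 := (sq _).symm
      _ = Rβ * (σ 0 e : ℝ) ^ B * (F : ℝ) ^ 2 * (Real.sqrt (M + 1) * Sα) := by rw [hReq]; ring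
  -- large moduli `F < d ≤ Qn`: the large sieve
  have hlarge : ∀ e : ℕ, ∑ d ∈ Ioc F Qn, (Nat.totient d : ℝ)⁻¹ * H d e ≤
      (2 * Real.sqrt (M + 2) * Real.sqrt (N + 2) / F +
          3 * K * (Real.sqrt (M + 2) + Real.sqrt (N + 2)) + 9 * F * 2 ^ K) * (Sα * Sβ) := by
    intro e
    have h1 : ∑ d ∈ Ioc F Qn, (Nat.totient d : ℝ)⁻¹ * H d e ≤
        ∑ d ∈ Ioc F Qn, (Nat.totient d : ℝ)⁻¹ *
          ∑ ψ : DirichletCharacter ℂ d with ψ.IsPrimitive,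
            ‖∑ m ∈ dyadic M, cα e m * ψ m‖ * ‖∑ n ∈ dyadic N, cβ e n * ψ n‖ := by
      refine Finset.sum_le_sum fun d _ =>
        mul_le_mul_of_nonneg_left ?_ (inv_nonneg.2 (Nat.cast_nonneg _))
      simp only [hH]
      refine Finset.sum_le_sum fun ψ _ => ?_
      split_ifs
      · positivity
      · exact le_rfl
    refine h1.trans ((sum_Ioc_inv_totient_mul_le_of_dyadic (cα e) (cβ e) hM hN0 hF K Qn hK).trans
      ?_)
    have hA2 : Real.sqrt (∑ m ∈ dyadic M, ‖cα e m‖ ^ 2) ≤ Sα := Real.sqrt_le_sqrt (hcαle e)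
    have hB2 : Real.sqrt (∑ n ∈ dyadic N, ‖cβ e n‖ ^ 2) ≤ Sβ := Real.sqrt_le_sqrt (hcβle e)
    have hF0 : (0 : ℝ) < F := by exact_mod_cast hF
    refine mul_le_mul_of_nonneg_left (mul_le_mul hA2 hB2 (Real.sqrt_nonneg _)
      (Real.sqrt_nonneg _)) (by positivity)
  -- conclusion
  calc ∑ q ∈ Icc 1 Qn, |bilinDisc (a q) M N α β q|
      ≤ ∑ e ∈ Icc 1 Qn, (Nat.totient e : ℝ)⁻¹ *
          ∑ d ∈ Icc 1 Qn, (Nat.totient d : ℝ)⁻¹ * H d e := hT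
    _ ≤ ∑ e ∈ Icc 1 Qn, (Nat.totient e : ℝ)⁻¹ *
          (Rβ * (σ 0 e : ℝ) ^ B * (F : ℝ) ^ 2 * (Real.sqrt (M + 1) * Sα) +
            (2 * Real.sqrt (M + 2) * Real.sqrt (N + 2) / F +
              3 * K * (Real.sqrt (M + 2) + Real.sqrt (N + 2)) + 9 * F * 2 ^ K) * (Sα * Sβ)) :=
        Finset.sum_le_sum fun e he => mul_le_mul_of_nonneg_left
          ((hsplit e).trans (add_le_add (hsmall e he) (hlarge e)))
          (inv_nonneg.2 (Nat.cast_nonneg _))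
    _ = _ := by
        rw [Finset.mul_sum, Finset.mul_sum, ← Finset.sum_add_distrib]
        refine Finset.sum_congr rfl fun e _ => ?_
        rw [hRβ, div_eq_mul_inv ((σ 0 e : ℝ) ^ B)]
        ring

/-! ### Step 7: the choice of the parameters (BFI p. 213: "Take `B₁ = A + 2`, `F = ℒ^{B₁}`,
`A' = 5A/2 + B₂ + 3`"; here `F = ⌈ℒ^{A+2}⌉`, `B₁ = 2A + 4`, `A' = 3A + 4 + 2^{⌈B⌉+2}`) -/

/-- The large-conductor terms after the choice of parameters: with `L ≥ 1`,
`L^{A+2} ≤ F ≤ 2L^{A+2}`, `2^K ≤ 2Qn + 2`, `K ≤ 2L`, `Qn ≤ x^{1/2} L^{−2A−4}`,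
`M, N ≤ min(x, x^{1−ε})`, `MN = x`, and the two eventual inequalities `L^{A+3} ≤ x^{ε/2}`,
`L^{2A+4} ≤ x^{1/2}`,
`(2√(M+2)√(N+2)/F + 3K(√(M+2)+√(N+2)) + 9F2^K) · 4L² ≤ 408 x^{1/2} L^{−A}`. [folklore] -/
theorem thm0b_large_numerics {x ε A L M N : ℝ} {F K Qn : ℕ} (hx1 : 1 ≤ x) (hε : 0 < ε)
    (hε1 : ε ≤ 1 / 2) (hL1 : 1 ≤ L) (hM0 : 0 ≤ M) (hN0 : 0 ≤ N) (hMN : M * N = x)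
    (hMx : M ≤ x) (hNx : N ≤ x) (hMε : M ≤ x ^ (1 - ε)) (hNε : N ≤ x ^ (1 - ε))
    (hFge : L ^ (A + 2) ≤ F) (hFle : (F : ℝ) ≤ 2 * L ^ (A + 2)) (h2K : (2 : ℝ) ^ K ≤ 2 * Qn + 2)
    (hKL : (K : ℝ) ≤ 2 * L) (hQn : (Qn : ℝ) ≤ x ^ (1 / 2 : ℝ) / L ^ (2 * A + 4))
    (hE1 : L ^ (A + 3) ≤ x ^ (ε / 2)) (hE2 : L ^ (2 * A + 4) ≤ x ^ (1 / 2 : ℝ)) :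
    (2 * Real.sqrt (M + 2) * Real.sqrt (N + 2) / F +
        3 * K * (Real.sqrt (M + 2) + Real.sqrt (N + 2)) + 9 * F * 2 ^ K) * (4 * L ^ 2) ≤
      408 * (Real.sqrt x / L ^ A) := by
  have hx0 : 0 < x := by linarith
  have hL0 : 0 < L := by linarith
  have hLA : 0 < L ^ A := Real.rpow_pos_of_pos hL0 _
  set W : ℝ := Real.sqrt x / L ^ A with hW
  set P : ℝ := Real.sqrt (M + 2) with hP
  set R : ℝ := Real.sqrt (N + 2) with hR
  have hsx : Real.sqrt x = x ^ (1 / 2 : ℝ) := Real.sqrt_eq_rpow x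
  have hx1ε : 1 ≤ x ^ (1 - ε) := Real.one_le_rpow hx1 (by linarith)
  -- `P, R ≤ 2 x^{(1-ε)/2}`
  have hsq : (2 * x ^ ((1 - ε) / 2)) ^ 2 = 4 * x ^ (1 - ε) := by
    have e : (x ^ ((1 - ε) / 2)) ^ 2 = x ^ (1 - ε) := by
      rw [← Real.rpow_natCast (x ^ ((1 - ε) / 2)) 2, ← Real.rpow_mul hx0.le]
      congr 1
      push_cast
      ring
    rw [mul_pow, e]
    norm_num
  have hP2 : P ≤ 2 * x ^ ((1 - ε) / 2) := by
    rw [hP, Real.sqrt_le_left (by positivity), hsq]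
    linarith
  have hR2 : R ≤ 2 * x ^ ((1 - ε) / 2) := by
    rw [hR, Real.sqrt_le_left (by positivity), hsq]
    linarith
  -- `P R ≤ 3 √x`
  have hPR : P * R ≤ 3 * Real.sqrt x := by
    rw [hP, hR, ← Real.sqrt_mul (by positivity),
      show (3 : ℝ) * Real.sqrt x = Real.sqrt (9 * x) by
        rw [Real.sqrt_mul (by norm_num), show (9 : ℝ) = 3 ^ 2 by norm_num,
          Real.sqrt_sq (by norm_num)]]
    exact Real.sqrt_le_sqrt (by nlinarith)
  -- term 1
  have ht1 : 2 * P * R / F * (4 * L ^ 2) ≤ 24 * W := by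
    have h1 : 2 * P * R / F ≤ 6 * Real.sqrt x / L ^ (A + 2) :=
      div_le_div₀ (by positivity) (by nlinarith [hPR]) (by positivity) hFge
    have h2 : L ^ (A + 2) = L ^ A * L ^ 2 := by rw [Real.rpow_add hL0, Real.rpow_two]
    calc 2 * P * R / F * (4 * L ^ 2) ≤ 6 * Real.sqrt x / L ^ (A + 2) * (4 * L ^ 2) := by gcongr
      _ = 24 * W := by
          rw [h2, hW]
          field_simp
          ring
  -- term 2
  have hxhalf : x ^ (1 / 2 : ℝ) = x ^ ((1 - ε) / 2) * x ^ (ε / 2) := by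
    rw [← Real.rpow_add hx0]
    congr 1
    ring
  have hL3 : L ^ (A + 3) = L ^ A * L ^ 3 := by
    rw [Real.rpow_add hL0, show (3 : ℝ) = (3 : ℕ) by norm_num, Real.rpow_natCast]
  have hkey2 : L ^ 3 * x ^ ((1 - ε) / 2) ≤ W := by
    rw [hW, le_div_iff₀ hLA, hsx, hxhalf]
    calc L ^ 3 * x ^ ((1 - ε) / 2) * L ^ A = L ^ (A + 3) * x ^ ((1 - ε) / 2) := by
          rw [hL3]; ring
      _ ≤ x ^ (ε / 2) * x ^ ((1 - ε) / 2) := mul_le_mul_of_nonneg_right hE1 (by positivity)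
      _ = x ^ ((1 - ε) / 2) * x ^ (ε / 2) := mul_comm _ _
  have ht2 : 3 * K * (P + R) * (4 * L ^ 2) ≤ 96 * W := by
    have hPR4 : P + R ≤ 4 * x ^ ((1 - ε) / 2) := by linarith
    calc 3 * K * (P + R) * (4 * L ^ 2) ≤ 3 * (2 * L) * (P + R) * (4 * L ^ 2) :=
          mul_le_mul_of_nonneg_right (mul_le_mul_of_nonneg_right
            (mul_le_mul_of_nonneg_left hKL (by norm_num)) (by positivity)) (by positivity)
      _ ≤ 3 * (2 * L) * (4 * x ^ ((1 - ε) / 2)) * (4 * L ^ 2) :=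
          mul_le_mul_of_nonneg_right (mul_le_mul_of_nonneg_left hPR4 (by positivity))
            (by positivity)
      _ = 96 * (L ^ 3 * x ^ ((1 - ε) / 2)) := by ring
      _ ≤ 96 * W := by linarith [hkey2]
  -- term 3
  have hL24 : L ^ (2 * A + 4) = L ^ A * L ^ (A + 4) := by
    rw [← Real.rpow_add hL0]
    congr 1
    ring
  have hLA4 : L ^ (A + 4) = L ^ (A + 2) * L ^ 2 := by
    rw [← Real.rpow_two, ← Real.rpow_add hL0]
    congr 1
    ring
  have hkey3 : L ^ (A + 4) ≤ W := by
    rw [hW, le_div_iff₀ hLA, hsx]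
    calc L ^ (A + 4) * L ^ A = L ^ (2 * A + 4) := by rw [hL24]; ring
      _ ≤ x ^ (1 / 2 : ℝ) := hE2
  have hQnW : L ^ (A + 4) * Qn ≤ W := by
    calc L ^ (A + 4) * Qn ≤ L ^ (A + 4) * (x ^ (1 / 2 : ℝ) / L ^ (2 * A + 4)) :=
          mul_le_mul_of_nonneg_left hQn (by positivity)
      _ = W := by
          rw [hL24, hW, hsx]
          have : L ^ (A + 4) ≠ 0 := (Real.rpow_pos_of_pos hL0 _).ne'
          field_simp
  have ht3 : 9 * F * 2 ^ K * (4 * L ^ 2) ≤ 288 * W := by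
    calc 9 * F * 2 ^ K * (4 * L ^ 2) ≤ 9 * (2 * L ^ (A + 2)) * (2 * Qn + 2) * (4 * L ^ 2) := by
          gcongr
      _ = 144 * (L ^ (A + 2) * L ^ 2) * Qn + 144 * (L ^ (A + 2) * L ^ 2) := by ring
      _ = 144 * (L ^ (A + 4) * Qn) + 144 * L ^ (A + 4) := by rw [hLA4]; ring
      _ ≤ 144 * W + 144 * W := by linarith [hkey3, hQnW]
      _ = 288 * W := by ring
  calc (2 * P * R / F + 3 * K * (P + R) + 9 * F * 2 ^ K) * (4 * L ^ 2)
      = 2 * P * R / F * (4 * L ^ 2) + 3 * K * (P + R) * (4 * L ^ 2) +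
          9 * F * 2 ^ K * (4 * L ^ 2) := by ring
    _ ≤ 24 * W + 96 * W + 288 * W := by linarith
    _ = 408 * W := by ring

/-- The small-conductor term after the choice of parameters: with `(M+1)N ≤ 2x`,
`(εL)^{A'} ≤ (log 2N)^{A'}` (`A' = 3A + 4 + c`), `F ≤ 2L^{A+2}`,
`C' N^{1/2} (log 2N)^{−A'} F² (M+1)^{1/2} · C_τ L^{c} ≤ 4√2 C' C_τ ε^{−A'} x^{1/2} L^{−A}`.
[folklore] -/
theorem thm0b_small_numerics {x ε A L M N C' Cτ D : ℝ} {F c : ℕ} (hx1 : 1 ≤ x) (hε : 0 < ε)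
    (hL1 : 1 ≤ L) (hC' : 0 ≤ C') (hCτ : 0 ≤ Cτ) (hM0 : 0 ≤ M) (hN0 : 0 ≤ N)
    (hMN : (M + 1) * N ≤ 2 * x) (hD : (ε * L) ^ (3 * A + 4 + c) ≤ D)
    (hFle : (F : ℝ) ≤ 2 * L ^ (A + 2)) :
    C' * N ^ (1 / 2 : ℝ) / D * (F : ℝ) ^ 2 * Real.sqrt (M + 1) * (Cτ * L ^ c) ≤
      4 * Real.sqrt 2 * C' * Cτ * ε⁻¹ ^ (3 * A + 4 + c) * (Real.sqrt x / L ^ A) := by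
  have hx0 : 0 < x := by linarith
  have hL0 : 0 < L := by linarith
  set A' : ℝ := 3 * A + 4 + c with hA'
  have hεL : 0 < ε * L := mul_pos hε hL0
  have hD' : 0 < (ε * L) ^ A' := Real.rpow_pos_of_pos hεL _
  have hD0 : 0 < D := lt_of_lt_of_le hD' hD
  -- `N^{1/2} √(M+1) ≤ √2 √x`
  have h1 : N ^ (1 / 2 : ℝ) * Real.sqrt (M + 1) ≤ Real.sqrt 2 * Real.sqrt x := by
    rw [← Real.sqrt_eq_rpow, ← Real.sqrt_mul hN0, ← Real.sqrt_mul (by norm_num)]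
    exact Real.sqrt_le_sqrt (by nlinarith)
  -- `F² ≤ 4 (L^{A+2})²`
  have h2 : (F : ℝ) ^ 2 ≤ 4 * (L ^ (A + 2)) ^ 2 := by
    calc (F : ℝ) ^ 2 ≤ (2 * L ^ (A + 2)) ^ 2 := pow_le_pow_left₀ (Nat.cast_nonneg _) hFle 2
      _ = 4 * (L ^ (A + 2)) ^ 2 := by ring
  -- `L^{A'} = (L^{A+2})² L^c L^A`
  have hLA' : L ^ A' = (L ^ (A + 2)) ^ 2 * L ^ c * L ^ A := by
    rw [← Real.rpow_natCast L c, ← Real.rpow_natCast (L ^ (A + 2)) 2, ← Real.rpow_mul hL0.le,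
      ← Real.rpow_add hL0, ← Real.rpow_add hL0, hA']
    congr 1
    push_cast
    ring
  have hrew : C' * N ^ (1 / 2 : ℝ) / D * (F : ℝ) ^ 2 * Real.sqrt (M + 1) * (Cτ * L ^ c) =
      C' * Cτ * (N ^ (1 / 2 : ℝ) * Real.sqrt (M + 1)) * (F : ℝ) ^ 2 * L ^ c / D := by
    field_simp
  rw [hrew]
  calc C' * Cτ * (N ^ (1 / 2 : ℝ) * Real.sqrt (M + 1)) * (F : ℝ) ^ 2 * L ^ c / D
      ≤ C' * Cτ * (Real.sqrt 2 * Real.sqrt x) * (4 * (L ^ (A + 2)) ^ 2) * L ^ c /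
          (ε * L) ^ A' := by
        refine div_le_div₀ (by positivity) ?_ hD' hD
        gcongr
    _ = 4 * Real.sqrt 2 * C' * Cτ * ε⁻¹ ^ A' * (Real.sqrt x / L ^ A) := by
        rw [Real.mul_rpow hε.le hL0.le, Real.inv_rpow hε.le, hLA']
        have h3 : L ^ (A + 2) ≠ 0 := (Real.rpow_pos_of_pos hL0 _).ne'
        have h4 : L ^ A ≠ 0 := (Real.rpow_pos_of_pos hL0 _).ne'
        have h5 : ε ^ A' ≠ 0 := (Real.rpow_pos_of_pos hε _).ne'
        have h6 : (L : ℝ) ^ c ≠ 0 := pow_ne_zero _ hL0.ne'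
        field_simp

/-! ### Theorem 0 (b) -/

open Filter in
/-- **Bombieri–Friedlander–Iwaniec 1986, Theorem 0 (b), PROVED** (the Bombieri–Vinogradov theorem
for bilinear forms `α ⋆ β` under (A₁), (A₂); BFI §2, pp. 211–213, "essentially due to
Y. Motohashi"): discharge of `Literature.NumberTheory.Sieve.BombieriFriedlanderIwaniecTheorem0b`,
with `B₁ = 2A + 4`.  Proof as printed (pp. 212–213): orthogonality of characters, reduction to
primitive characters, hypothesis (A₂) for conductors `≤ F = ⌈ℒ^{A+2}⌉` and the multiplicative large
sieve (`Literature.NumberTheory.Sieve.LargeSieve.largeSieve_bilinear`, Cojocaru–Murty Thm 8.3.1) on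
dyadic blocks of conductors `> F`; the weights `∑_e τ(e)^B/φ(e) ≪ ℒ^{B₂}` are
`Literature.NumberTheory.Sieve.exists_sum_sigma_zero_pow_div_totient_le_real`.
[cite: BombieriFriedlanderIwaniecActa1986, §2 Theorem 0 (b) pp. 211–213] -/
theorem _root_.Literature.NumberTheory.Sieve.BombieriFriedlanderIwaniecTheorem0b_holds :
    BombieriFriedlanderIwaniecTheorem0b := by
  intro ε hε A hA B hB Csw
  -- constants depending on `ε, A, B, Csw` only
  set r : ℕ := ⌈B⌉₊ with hr
  obtain ⟨Cτ, hCτ, hτ⟩ := exists_sum_sigma_zero_pow_div_totient_le_real r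
  set c : ℕ := 2 ^ (r + 2) with hc
  set A' : ℝ := 3 * A + 4 + c with hA'def
  have hA' : 0 < A' := by positivity
  set C' : ℝ := max (Csw A') 0 with hC'def
  have hC' : 0 ≤ C' := le_max_right _ _
  -- the threshold `x₀`
  obtain ⟨x₀, hx₀⟩ := Filter.eventually_atTop.1 ((eventually_ge_atTop (3 : ℝ)).and
    ((eventually_log_rpow_le_rpow (A + 3) (half_pos hε)).and
      (eventually_log_rpow_le_rpow (2 * A + 4) (by norm_num : (0 : ℝ) < 1 / 2))))
  refine ⟨2 * A + 4, 408 + 4 * Real.sqrt 2 * C' * Cτ * ε⁻¹ ^ A', x₀, by positivity, ?_⟩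
  intro x hx M N hMN hN1 hN2 β hβ α Q hQ a ha
  obtain ⟨hx3, hE1, hE2⟩ := hx₀ x hx
  -- `x`, `L = log x`
  have hx1 : (1 : ℝ) ≤ x := by linarith
  have hx0 : 0 < x := by linarith
  set L := Real.log x with hL
  have hL1 : 1 ≤ L := by
    rw [hL, ← Real.log_exp 1]
    refine Real.log_le_log (Real.exp_pos 1) ?_
    have := Real.exp_one_lt_d9
    linarith
  have hL0 : 0 < L := by linarith
  -- `N`, `M`, `ε`
  have hN1' : 1 ≤ N := le_trans (Real.one_le_rpow hx1 hε.le) hN1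
  have hNpos : 0 < N := by linarith
  have hε1 : ε ≤ 1 / 2 := by
    have h := (Real.rpow_le_rpow_left_iff (by linarith : 1 < x)).1 (hN1.trans hN2)
    linarith
  have hNx : N ≤ x := hN2.trans (by
    have := Real.rpow_le_rpow_of_exponent_le hx1 (by linarith : 1 - ε ≤ 1)
    rwa [Real.rpow_one] at this)
  have hM : M = x / N := by
    field_simp
    linarith
  have hM0 : 0 ≤ M := by rw [hM]; positivity
  have hMx : M ≤ x := by rw [hM]; exact div_le_self hx0.le hN1'
  have hMε : M ≤ x ^ (1 - ε) := by
    rw [hM, div_le_iff₀ hNpos]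
    calc x = x ^ (1 - ε) * x ^ ε := by
          rw [← Real.rpow_add hx0]; norm_num
      _ ≤ x ^ (1 - ε) * N := mul_le_mul_of_nonneg_left hN1 (by positivity)
  have hMN2 : (M + 1) * N ≤ 2 * x := by
    calc (M + 1) * N = M * N + N := by ring
      _ ≤ 2 * x := by linarith
  -- `Qn = ⌊Q⌋`
  set Qn : ℕ := ⌊Q⌋₊ with hQn
  have hLB : 0 < L ^ (2 * A + 4) := Real.rpow_pos_of_pos hL0 _
  have hQn_le : (Qn : ℝ) ≤ x ^ (1 / 2 : ℝ) / L ^ (2 * A + 4) := by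
    rcases le_or_gt 0 Q with hQ0 | hQ0
    · exact (Nat.floor_le hQ0).trans hQ
    · rw [hQn, Nat.floor_of_nonpos hQ0.le, Nat.cast_zero]
      positivity
  have hsqrt_le : x ^ (1 / 2 : ℝ) ≤ x := by
    have := Real.rpow_le_rpow_of_exponent_le hx1 (by norm_num : (1 / 2 : ℝ) ≤ 1)
    rwa [Real.rpow_one] at this
  have hQn_sqrt : (Qn : ℝ) ≤ x ^ (1 / 2 : ℝ) :=
    hQn_le.trans (div_le_self (by positivity) (Real.one_le_rpow hL1 (by positivity)))
  have hQn_x : (Qn : ℝ) ≤ x := hQn_sqrt.trans hsqrt_le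
  -- `F = ⌈L^{A+2}⌉`, `K = log₂ Qn + 1`
  set F : ℕ := ⌈L ^ (A + 2)⌉₊ with hFdef
  have hLA2 : 1 ≤ L ^ (A + 2) := Real.one_le_rpow hL1 (by positivity)
  have hFge : L ^ (A + 2) ≤ F := Nat.le_ceil _
  have hF1 : 1 ≤ F := by
    have : (1 : ℝ) ≤ F := hLA2.trans hFge
    exact_mod_cast this
  have hFle : (F : ℝ) ≤ 2 * L ^ (A + 2) := by
    have := (Nat.ceil_lt_add_one (by positivity : 0 ≤ L ^ (A + 2))).le
    linarith
  set K : ℕ := Nat.log 2 Qn + 1 with hKdef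
  have hK : Qn ≤ F * 2 ^ K :=
    (Nat.lt_pow_succ_log_self one_lt_two Qn).le.trans (Nat.le_mul_of_pos_left _ hF1)
  have h2K : (2 : ℝ) ^ K ≤ 2 * Qn + 2 := by
    have : (2 : ℕ) ^ K ≤ 2 * Qn + 2 := by
      rcases Nat.eq_zero_or_pos Qn with h0 | hpos
      · simp [hKdef, h0]
      · have := Nat.pow_log_le_self 2 hpos.ne'
        calc 2 ^ K = 2 * 2 ^ Nat.log 2 Qn := by rw [hKdef, pow_succ]; ring
          _ ≤ 2 * Qn + 2 := by omega
    exact_mod_cast this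
  have hKL : (K : ℝ) ≤ 2 * L := by
    have hlogle : (Nat.log 2 Qn : ℝ) ≤ L := by
      rcases Nat.eq_zero_or_pos Qn with h0 | hpos
      · rw [h0, Nat.log_zero_right, Nat.cast_zero]; exact hL0.le
      · have h1 : (2 : ℝ) ^ (Nat.log 2 Qn) ≤ Qn := by
          exact_mod_cast Nat.pow_log_le_self 2 hpos.ne'
        have h3 : (Nat.log 2 Qn : ℝ) * Real.log 2 ≤ Real.log Qn := by
          rw [← Real.log_pow]; exact Real.log_le_log (by positivity) h1
        have h4 : Real.log Qn ≤ L / 2 := by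
          calc Real.log Qn ≤ Real.log (x ^ (1 / 2 : ℝ)) :=
                Real.log_le_log (by exact_mod_cast hpos) hQn_sqrt
            _ = L / 2 := by rw [Real.log_rpow hx0]; ring
        have h5 : (1 / 2 : ℝ) < Real.log 2 := by linarith [Real.log_two_gt_d9]
        have h6 : (Nat.log 2 Qn : ℝ) ≤ L / 2 / Real.log 2 := by
          rw [le_div_iff₀ (by linarith)]; linarith
        refine h6.trans ?_
        rw [div_le_iff₀ (by linarith)]
        nlinarith
    calc (K : ℝ) = Nat.log 2 Qn + 1 := by rw [hKdef]; push_cast; ring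
      _ ≤ 2 * L := by linarith
  -- the sums over `e`
  have hsumτ : ∑ e ∈ Icc 1 Qn, (σ 0 e : ℝ) ^ B / (Nat.totient e : ℝ) ≤ Cτ * L ^ c := by
    set y : ℝ := max (Qn : ℝ) 2 with hy
    have hy2 : 2 ≤ y := le_max_right _ _
    have hyx : y ≤ x := max_le hQn_x (by linarith)
    have hQny : Qn ≤ ⌊y⌋₊ := Nat.le_floor (le_max_left _ _)
    have hτB : ∀ e ∈ Icc 1 Qn, (σ 0 e : ℝ) ^ B / (Nat.totient e : ℝ) ≤
        (σ 0 e : ℝ) ^ r / (Nat.totient e : ℝ) := by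
      intro e he
      have he1 : 1 ≤ e := (Finset.mem_Icc.1 he).1
      have h1 : (1 : ℝ) ≤ σ 0 e := by exact_mod_cast one_le_sigma_zero (by omega)
      refine div_le_div_of_nonneg_right ?_ (Nat.cast_nonneg _)
      calc (σ 0 e : ℝ) ^ B ≤ (σ 0 e : ℝ) ^ (r : ℝ) :=
            Real.rpow_le_rpow_of_exponent_le h1 (Nat.le_ceil B)
        _ = (σ 0 e : ℝ) ^ r := Real.rpow_natCast _ _
    calc ∑ e ∈ Icc 1 Qn, (σ 0 e : ℝ) ^ B / (Nat.totient e : ℝ)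
        ≤ ∑ e ∈ Icc 1 Qn, (σ 0 e : ℝ) ^ r / (Nat.totient e : ℝ) := Finset.sum_le_sum hτB
      _ ≤ ∑ e ∈ Icc 1 ⌊y⌋₊, (σ 0 e : ℝ) ^ r / (Nat.totient e : ℝ) :=
          Finset.sum_le_sum_of_subset_of_nonneg (Finset.Icc_subset_Icc_right hQny)
            fun _ _ _ => by positivity
      _ ≤ Cτ * Real.log y ^ c := hτ y hy2
      _ ≤ Cτ * L ^ c := by
          gcongr
          · exact Real.log_nonneg (by linarith)
          · exact Real.log_le_log (by linarith) hyx
  have hsumφ : ∑ e ∈ Icc 1 Qn, (Nat.totient e : ℝ)⁻¹ ≤ 4 * L ^ 2 := by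
    have h1 := totientInvSum_le Qn
    rw [totientInvSum] at h1
    have hlogQn : Real.log Qn ≤ L := by
      rcases Nat.eq_zero_or_pos Qn with h0 | hpos
      · rw [h0, Nat.cast_zero, Real.log_zero]; exact hL0.le
      · exact Real.log_le_log (by exact_mod_cast hpos) hQn_x
    have hlogQn0 : 0 ≤ Real.log Qn := Real.log_natCast_nonneg Qn
    calc ∑ e ∈ Icc 1 Qn, (Nat.totient e : ℝ)⁻¹ ≤ (1 + Real.log Qn) ^ 2 := h1
      _ ≤ (2 * L) ^ 2 := pow_le_pow_left₀ (by linarith) (by linarith) 2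
      _ = 4 * L ^ 2 := by ring
  -- the skeleton estimate, with (A₂) for the positive parts of the constants
  have hβ' := hβ.pos_part hN1'
  have hmain := sum_abs_bilinDisc_le_main (Csw := fun A => max (Csw A) 0) (α := α) hM0 hN1' hβ'
    hA' hC' hF1 K Qn hK a ha
  -- numerics
  set Sα : ℝ := Real.sqrt (l2Sq M α) with hSα
  set Sβ : ℝ := Real.sqrt (l2Sq N β) with hSβ
  set W : ℝ := Real.sqrt x / L ^ A with hW
  have hW0 : 0 ≤ W := div_nonneg (Real.sqrt_nonneg _) (Real.rpow_pos_of_pos hL0 _).le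
  set D : ℝ := Real.log (2 * N) ^ A' with hDdef
  have hlog2N : ε * L ≤ Real.log (2 * N) := by
    calc ε * L = Real.log (x ^ ε) := by rw [Real.log_rpow hx0]
      _ ≤ Real.log N := Real.log_le_log (by positivity) hN1
      _ ≤ Real.log (2 * N) := Real.log_le_log hNpos (by linarith)
  have hD : (ε * L) ^ (3 * A + 4 + c) ≤ D :=
    Real.rpow_le_rpow (by positivity) hlog2N hA'.le
  have hD0 : 0 < D := Real.rpow_pos_of_pos (Real.log_pos (by linarith)) _
  set Λ : ℝ := 2 * Real.sqrt (M + 2) * Real.sqrt (N + 2) / F +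
    3 * K * (Real.sqrt (M + 2) + Real.sqrt (N + 2)) + 9 * F * 2 ^ K with hΛ
  have hF0 : (0 : ℝ) < F := by exact_mod_cast hF1
  have hΛ0 : 0 ≤ Λ := by positivity
  have hlarge : Λ * (4 * L ^ 2) ≤ 408 * W :=
    thm0b_large_numerics hx1 hε hε1 hL1 hM0 hNpos.le hMN hMx hNx hMε hN2 hFge hFle h2K hKL
      hQn_le hE1 hE2
  have hsmall : C' * N ^ (1 / 2 : ℝ) / D * (F : ℝ) ^ 2 * Real.sqrt (M + 1) * (Cτ * L ^ c) ≤
      4 * Real.sqrt 2 * C' * Cτ * ε⁻¹ ^ (3 * A + 4 + c) * W :=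
    thm0b_small_numerics hx1 hε hL1 hC' hCτ.le hM0 hNpos.le hMN2 hD hFle
  have hsx : Real.sqrt x = x ^ (1 / 2 : ℝ) := Real.sqrt_eq_rpow x
  have hmain' : ∑ q ∈ Icc 1 Qn, |bilinDisc (a q) M N α β q| ≤
      (C' * Sβ * N ^ (1 / 2 : ℝ) / D) * (F : ℝ) ^ 2 * (Real.sqrt (M + 1) * Sα) *
            ∑ e ∈ Icc 1 Qn, (σ 0 e : ℝ) ^ B / (Nat.totient e : ℝ) +
          Λ * (Sα * Sβ) * ∑ e ∈ Icc 1 Qn, (Nat.totient e : ℝ)⁻¹ := hmain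
  have hpref : 0 ≤ (C' * Sβ * N ^ (1 / 2 : ℝ) / D) * (F : ℝ) ^ 2 * (Real.sqrt (M + 1) * Sα) :=
    mul_nonneg (mul_nonneg (div_nonneg (by positivity) hD0.le) (by positivity)) (by positivity)
  have hSS : 0 ≤ Sα * Sβ := by positivity
  calc ∑ q ∈ Icc 1 Qn, |bilinDisc (a q) M N α β q|
      ≤ (C' * Sβ * N ^ (1 / 2 : ℝ) / D) * (F : ℝ) ^ 2 * (Real.sqrt (M + 1) * Sα) *
            ∑ e ∈ Icc 1 Qn, (σ 0 e : ℝ) ^ B / (Nat.totient e : ℝ) +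
          Λ * (Sα * Sβ) * ∑ e ∈ Icc 1 Qn, (Nat.totient e : ℝ)⁻¹ := hmain'
    _ ≤ (C' * Sβ * N ^ (1 / 2 : ℝ) / D) * (F : ℝ) ^ 2 * (Real.sqrt (M + 1) * Sα) *
            (Cτ * L ^ c) + Λ * (Sα * Sβ) * (4 * L ^ 2) :=
        add_le_add (mul_le_mul_of_nonneg_left hsumτ hpref)
          (mul_le_mul_of_nonneg_left hsumφ (mul_nonneg hΛ0 hSS))
    _ = Sα * Sβ * (C' * N ^ (1 / 2 : ℝ) / D * (F : ℝ) ^ 2 * Real.sqrt (M + 1) * (Cτ * L ^ c)) +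
          Sα * Sβ * (Λ * (4 * L ^ 2)) := by ring
    _ ≤ Sα * Sβ * (4 * Real.sqrt 2 * C' * Cτ * ε⁻¹ ^ (3 * A + 4 + c) * W) +
          Sα * Sβ * (408 * W) :=
        add_le_add (mul_le_mul_of_nonneg_left hsmall hSS) (mul_le_mul_of_nonneg_left hlarge hSS)
    _ = (408 + 4 * Real.sqrt 2 * C' * Cτ * ε⁻¹ ^ A') * Sα * Sβ * x ^ (1 / 2 : ℝ) / L ^ A := by
        rw [hW, hsx, hA'def]
        ring

end BFI

end Literature.NumberTheory.Sieve
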